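import Summits.FinalStateConjecture.FinalStateConjecture.Theses.ZeroEnergyKerrOrBomb
import Summits.FinalStateConjecture.FinalStateConjecture.Theorems.ZeroEnergyRigidity.Negative.MinkowskiPresentation
import Literature.Geometry.Lorentzian.MinkowskiGlobalHyperbolicity
import Literature.Geometry.Lorentzian.ExtensionProofs
import Literature.Geometry.Lorentzian.LeviCivitaProofs
import Literature.Geometry.Lorentzian.KerrDataProofs
import Literature.Geometry.Lorentzian.KerrSchildCoord
import Literature.Geometry.Manifold.InverseFunctionTheorem
import Literature.Geometry.Manifold.OpenSubmanifoldMFDeriv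

/-!
# `ZeroEnergyRigidity` (crux `stmt-FinalStateConjecture-10690`) is FALSE without h2:
# Minkowski spacetime is a horizonless `StationaryAFBlackHole` whose d.o.c. is no Kerr exterior

Negative-lane load-bearing analysis for the crux `ZeroEnergyRigidity` of route
`ZeroEnergyKerrOrBomb` (cdisprove seat, cycle 4).  The crux quantifies over stationary
asymptotically flat black holes `𝓑 : StationaryAFBlackHole` with hypotheses h1 vacuum,
h2 `𝓔⁺ = ∂I⁻(M_ext) ∩ I⁺(M_ext)` connected (hence non-empty), h3 `𝓔⁺` non-degenerate, h4 the
carrier globally hyperbolic, h5 `T ≠ 0` on the d.o.c., h6 no imprisoned zero-energy null ray, and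
concludes that the d.o.c. is the image of an injective isometric immersion of a sub-extremal Kerr
exterior chart `(Kerr.exterior M a, Kerr.smoothMetric M a r₊)`.

**Main result** (`zeroEnergyRigidity_false_without_H2`): the crux with h2 DELETED (everything else
verbatim) is false — *any proof of the crux must use the non-emptiness of the horizon*.  This
closes the near-miss `fullRigidity_false_without_H2` of `Cruxes/ZeroEnergyRigidity/Disproof.lean`
§ (e), unconditionally (no named fact, no instance hypothesis: `Kerr.Facts` and the Levi-Civita
hypothesis are discharged by tree theorems).

**Witness** (`minkowskiBH`): Minkowski spacetime `(ℝ⁴, η, ∂ₜ)` with the slice `{t = 0}`, the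
trivial data `(δ, 0)`, the end `{‖y‖ > 1}` and the Killing field `∂ₜ`, every structure field being
a theorem of the tree (`ModelData*`, `TrivialDataAdmissible`, `AsymptoticFlatnessProofs`,
`MinkowskiFlat`).  Its chronological future and past of `M_ext ⊇ {(t, y) : ‖y‖ > 2}` are all of
`ℝ⁴` (straight timelike segments), so `doc = ℝ⁴` and **`𝓔⁺ = ∅`** (`horizon_minkowskiBH`): h2
fails, h3 holds vacuously (the *Warning* in `Stationary.lean` on `IsNonDegenerateHorizon`), h1 is
`Minkowski.isRicciFlat_holds`, h4 is `Minkowski.isGloballyHyperbolic`, h5 is `∂ₜ ≠ 0`, and h6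
holds vacuously (a null `v` with `η(∂ₜ, v) = 0` is `0`).

**The conclusion fails** (`not_kerrConclusion_minkowskiBH`, from
`false_of_kerrExterior_isometric_minkowski`): a bijective isometric immersion
`Ψ : (Kerr.exterior M a, g_{M,a}) → (ℝ⁴, η)`, `|a| < M`, has invertible differential (pull-back
identity + non-degeneracy of `g_{M,a}`), hence is a diffeomorphism (inverse function theorem,
`Literature.Geometry.Manifold.isLocalDiffeomorphAt_of_mfderiv` + Mathlib's
`IsLocalDiffeomorph.diffeomorphOfBijective`); then `{r > r₊} ↪ {r > 0}` composed with `Ψ⁻¹` is a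
smooth isometric open embedding of Minkowski spacetime onto a PROPER open subset (a point of
spatial norm `r₊` has `0 < r ≤ r₊`) of the connected Kerr–Schild chart `({r > 0}, g_{M,a})` — a
`C^∞`, a fortiori `C⁰`, extension of Minkowski spacetime, contradicting Sbierski's theorem
(`minkowski_isC0Inextendible_holds`, proved in `ExtensionProofs.lean`).

For the planner / provers: h2 is genuinely load-bearing (not only "there is a black hole" flavour:
without it the AF vacuum stationary GH presentations include Minkowski space, whose d.o.c. is not
a Kerr exterior because `IsSubextremal M a` forces `M > 0`); together with `Negative/` files
`KillingNonvanishingOfGH` (h5 redundant), `HorizonKillingScaling` (h3's `κ` unoriented),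
`StationaryFieldRescaling` (`T` unnormalised), `KerrParameterSign`/`KerrTimeTranslation`
(tightness of the conclusion) this is the current load-bearing map of the crux.

References: J. Sbierski, *The `C⁰`-inextendibility of the Schwarzschild spacetime and the
spacelike diameter in Lorentzian geometry*, J. Differential Geom. 108 (2018) 319–378, Thm. 1;
B. O'Neill, *Semi-Riemannian geometry* (1983), Ch. 5 (Minkowski causality), Ch. 14;
P. T. Chruściel, J. L. Costa, Astérisque 321 (2008), §2 (`M_ext`, `⟨⟨M_ext⟩⟩`, `𝓔⁺`).
-/

noncomputable section

namespace Summit.FinalStateConjecture.FinalStateConjecture.Theorems.ZeroEnergyRigidity.Negative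

open Set Function Literature.Geometry.Lorentzian
open scoped Manifold ContDiff Topology

-- The metric and time orientation of `Minkowski.spacetime` (its fields, by `rfl`), written with
-- carrier syntactically `E4` so that the instances of `E4` apply (as in
-- `MinkowskiGlobalHyperbolicity.lean`).
local notation "η₄" => (LorentzianMetric.ofLE (n' := (∞ : ℕ∞ω)) Minkowski.metric le_top)
local notation "∂ₜ" => (TimeOrientation.ofLE (n' := (∞ : ℕ∞ω)) Minkowski.timeOrientation le_top)

/-! ## No Kerr exterior is isometric to Minkowski spacetime (Sbierski) -/

section NoKerrChart

/-- `r ≤ ‖x⃗‖` for the Kerr–Schild radius (copy of `Kerr.radius_le_spatialNorm`,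
`KerrWaveDecay.lean`, to keep the import cone small). [folklore] -/
theorem kerrRadius_le_spatialNorm (a : ℝ) (x : E4) : Kerr.radius a x ≤ E4.spatialNorm x := by
  have hq := Kerr.radius_quartic a x
  have hr := Kerr.radius_nonneg a x
  have hρ := E4.spatialNorm_nonneg x
  have hz : x 3 ^ 2 ≤ E4.spatialNorm x ^ 2 := by
    rw [E4.spatialNorm_sq]; nlinarith [sq_nonneg (x 1), sq_nonneg (x 2)]
  by_contra h
  push Not at h
  have h1 : E4.spatialNorm x ^ 2 < Kerr.radius a x ^ 2 := by nlinarith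
  have h2 : Kerr.radius a x ^ 2 * (Kerr.radius a x ^ 2 - E4.spatialNorm x ^ 2) ≤
      a ^ 2 * (E4.spatialNorm x ^ 2 - Kerr.radius a x ^ 2) := by nlinarith [sq_nonneg a]
  nlinarith [sq_nonneg a, mul_pos (lt_of_le_of_lt (sq_nonneg _) h1) (sub_pos.2 h1)]

/-- `r > 0` as soon as `‖x⃗‖ > |a|` (copy of `Kerr.radius_pos_of_abs_lt`,
`KerrConvergenceProofs.lean`). [folklore] -/
theorem kerrRadius_pos_of_abs_lt {a : ℝ} {x : E4} (h : |a| < E4.spatialNorm x) :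
    0 < Kerr.radius a x := by
  have hs : a ^ 2 < E4.spatialNorm x ^ 2 := sq_lt_sq' (abs_lt.mp h).1 (abs_lt.mp h).2
  have h2 : 0 < Kerr.radius a x ^ 2 := by
    rw [Kerr.radius_sq]
    have := Real.sqrt_nonneg ((E4.spatialNorm x ^ 2 - a ^ 2) ^ 2 + 4 * a ^ 2 * x 3 ^ 2)
    linarith
  rcases (Kerr.radius_nonneg a x).eq_or_lt with h0 | h0
  · rw [← h0] at h2
    norm_num at h2
  · exact h0

/-- A point of the chart `{r > 0}` NOT in the exterior `{r > r₊}`: spatial norm `r₊` (then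
`0 < r ≤ r₊` since `|a| < M ≤ r₊`). [folklore] -/
theorem exists_mem_region_not_mem_exterior {M a : ℝ} (hMa : Kerr.IsSubextremal M a) :
    ∃ x : E4, x ∈ Kerr.region a 0 ∧ x ∉ Kerr.region a (Kerr.rPlus M a) := by
  have hM : 0 < M := hMa.pos
  have hrp : M ≤ Kerr.rPlus M a := by
    unfold Kerr.rPlus
    linarith [Real.sqrt_nonneg (M ^ 2 - a ^ 2)]
  have ha : |a| < Kerr.rPlus M a := lt_of_lt_of_le hMa hrp
  obtain ⟨y, hy⟩ := exists_norm_eq E3 (le_of_lt (hM.trans_le hrp))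
  refine ⟨E4.ofTimeSpace 0 y, ?_, ?_⟩
  · rw [Kerr.mem_region, max_self]
    apply kerrRadius_pos_of_abs_lt
    rwa [E4.spatialNorm_ofTimeSpace, hy]
  · rw [Kerr.mem_region, not_lt]
    calc Kerr.radius a (E4.ofTimeSpace 0 y) ≤ E4.spatialNorm (E4.ofTimeSpace 0 y) :=
          kerrRadius_le_spatialNorm a _
      _ = Kerr.rPlus M a := by rw [E4.spatialNorm_ofTimeSpace, hy]
      _ ≤ max (Kerr.rPlus M a) 0 := le_max_left _ _

/-- Every chart metric `Kerr.smoothMetric M a r₀` is the pull-back of the Kerr–Schild section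
`z ↦ Kerr.bilin M a z` on `ℝ⁴` (junk off `{r > 0}`) along the inclusion `{r > max r₀ 0} ⊆ ℝ⁴` (the
inclusion has identity differential). [folklore] -/
theorem smoothMetric_val_eq_pullbackBilin [Kerr.Facts] (M a r₀ : ℝ) :
    (Kerr.smoothMetric M a r₀).toPseudoRiemannianMetric.val =
      pullbackBilin (I := 𝓘(ℝ, E4)) (I' := 𝓘(ℝ, E4))
        (Subtype.val : Kerr.region a r₀ → E4)
        (fun z : E4 ↦ (Kerr.bilin M a z :
          TangentSpace 𝓘(ℝ, E4) z →L[ℝ] TangentSpace 𝓘(ℝ, E4) z →L[ℝ] ℝ)) := by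
  funext y
  ext v w
  rw [pullbackBilin_apply, Literature.Geometry.Manifold.OpenSubmanifold.mfderiv_subtype_val]
  rfl

/-- An isometric immersion of a Lorentzian `4`-manifold chart into Minkowski space has
injective, hence invertible, differential. [folklore] -/
theorem exists_equiv_mfderiv_of_isIsometricImmersion [Kerr.Facts] {M a : ℝ}
    {Ψ : Kerr.region a (Kerr.rPlus M a) → E4}
    (hiso : PseudoRiemannianMetric.IsIsometricImmersion
      (Kerr.smoothMetric M a (Kerr.rPlus M a)).toPseudoRiemannianMetric
      (η₄).toPseudoRiemannianMetric Ψ) (y : Kerr.region a (Kerr.rPlus M a)) :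
    ∃ e : E4 ≃L[ℝ] E4, mfderiv 𝓘(ℝ, E4) 𝓘(ℝ, E4) Ψ y = (e : E4 →L[ℝ] E4) := by
  set L : E4 →L[ℝ] E4 := mfderiv 𝓘(ℝ, E4) 𝓘(ℝ, E4) Ψ y with hL
  have hker : ∀ v : E4, L v = 0 → v = 0 := by
    intro v hv
    apply Kerr.bilin_nondegenerate M a (Kerr.radius_pos_of_mem_region y.2) v
    intro w
    have h := congrArg (fun B ↦ B v w) (hiso.2 y)
    simp only [pullbackBilin_apply] at h
    change Minkowski.bilin (L v) (L w) = Kerr.bilin M a y.1 v w at h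
    rw [← h, hv]
    simp [-Minkowski.bilin_apply]
  have hinj : Function.Injective (L : E4 →ₗ[ℝ] E4) := by
    intro v₁ v₂ hv
    have h0 : L (v₁ - v₂) = 0 := by
      rw [map_sub]
      exact sub_eq_zero.mpr hv
    exact sub_eq_zero.mp (hker _ h0)
  have hsurj : Function.Surjective (L : E4 →ₗ[ℝ] E4) :=
    LinearMap.injective_iff_surjective.mp hinj
  refine ⟨LinearEquiv.toContinuousLinearEquiv (LinearEquiv.ofBijective (L : E4 →ₗ[ℝ] E4)
    ⟨hinj, hsurj⟩), ?_⟩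
  ext v
  rfl

/-- **No sub-extremal Kerr exterior is isometric to Minkowski spacetime.**  If
`Ψ : {r > r₊} → ℝ⁴` were a bijective isometric immersion of `(Kerr.region a (Kerr.rPlus M a), g_{M,a})` onto
`(ℝ⁴, η)`, then `Ψ` is a diffeomorphism (inverse function theorem) and the inclusion
`{r > r₊} ⊊ {r > 0}` composed with `Ψ⁻¹` would be a smooth isometric open embedding of Minkowski
spacetime onto a proper open subset of the connected Kerr–Schild chart `({r > 0}, g_{M,a})` — a
`C^∞` (a fortiori `C⁰`) extension of Minkowski spacetime, contradicting Sbierski's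
`C⁰`-inextendibility theorem (`minkowski_isC0Inextendible_holds`). [folklore] -/
theorem false_of_kerrExterior_isometric_minkowski [Kerr.Facts] {M a : ℝ}
    (hMa : Kerr.IsSubextremal M a) (Ψ : Kerr.region a (Kerr.rPlus M a) → E4) (hinj : Function.Injective Ψ)
    (hsurj : Function.Surjective Ψ)
    (hiso : PseudoRiemannianMetric.IsIsometricImmersion
      (Kerr.smoothMetric M a (Kerr.rPlus M a)).toPseudoRiemannianMetric
      (η₄).toPseudoRiemannianMetric Ψ) : False := by
  -- `Ψ` is a local diffeomorphism, hence a diffeomorphism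
  have hloc : IsLocalDiffeomorph 𝓘(ℝ, E4) 𝓘(ℝ, E4) ∞ Ψ := fun y ↦ by
    obtain ⟨e, he⟩ := exists_equiv_mfderiv_of_isIsometricImmersion hiso y
    exact Literature.Geometry.Manifold.isLocalDiffeomorphAt_of_mfderiv (by simp) isOpen_univ
      (mem_univ y) hiso.1.contMDiffOn e he
  set Φ := hloc.diffeomorphOfBijective ⟨hinj, hsurj⟩ with hΦ_def
  have hΦ : ∀ y, Φ y = Ψ y := fun _ ↦ rfl
  -- the target chart `{r > 0}` and the extension map
  have hsub : ∀ x : E4, x ∈ Kerr.region a (Kerr.rPlus M a) → x ∈ Kerr.region a 0 := fun x hx ↦ by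
    rw [Kerr.mem_region, max_self]
    exact Kerr.radius_pos_of_mem_region hx
  obtain ⟨ι, hvalι⟩ : ∃ ι : E4 → Kerr.region a 0, Subtype.val ∘ ι = Subtype.val ∘ Φ.symm :=
    ⟨fun z ↦ ⟨(Φ.symm z : Kerr.region a (Kerr.rPlus M a)).1, hsub _ (Φ.symm z).2⟩, rfl⟩
  have hsmooth : ContMDiff 𝓘(ℝ, E4) 𝓘(ℝ, E4) ∞ (Subtype.val ∘ ι) := by
    rw [hvalι]
    exact contMDiff_subtype_val.comp Φ.symm.contMDiff
  have hcι : ContMDiff 𝓘(ℝ, E4) 𝓘(ℝ, E4) ∞ ι :=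
    (ContMDiff.subtypeVal_comp_iff (Kerr.region a 0) ι).1 hsmooth
  have hmdι : MDifferentiable 𝓘(ℝ, E4) 𝓘(ℝ, E4) ι := hcι.mdifferentiable (by simp)
  have hval_region : MDifferentiable 𝓘(ℝ, E4) 𝓘(ℝ, E4) (Subtype.val : Kerr.region a 0 → E4) :=
    fun y ↦ Literature.Geometry.Manifold.OpenSubmanifold.mdifferentiableAt_subtype_val
      (I := 𝓘(ℝ, E4)) (M := E4) (U := Kerr.region a 0) y
  have hval_ext : MDifferentiable 𝓘(ℝ, E4) 𝓘(ℝ, E4) (Subtype.val : Kerr.region a (Kerr.rPlus M a) → E4) :=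
    fun y ↦ Literature.Geometry.Manifold.OpenSubmanifold.mdifferentiableAt_subtype_val
      (I := 𝓘(ℝ, E4)) (M := E4) (U := Kerr.region a (Kerr.rPlus M a)) y
  set 𝓜' : LorentzianManifold.{0} 4 ∞ := (Kerr.spacetime M a 0 hMa.pos.le).toLorentzianManifold
    with h𝓜'
  apply minkowski_isC0Inextendible_holds
  refine LorentzianManifold.isExtendible_mono bot_le ⟨𝓜', ι, hcι, ?_, ?_, ?_⟩
  · -- open embedding
    refine Topology.IsOpenEmbedding.of_comp ι (Kerr.region a 0).isOpenEmbedding' ?_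
    rw [hvalι]
    exact (Kerr.region a (Kerr.rPlus M a)).isOpenEmbedding'.comp
      Φ.symm.toHomeomorph.isOpenEmbedding
  · -- isometric
    intro x
    have hval0 := smoothMetric_val_eq_pullbackBilin M a 0
    have hvalP := smoothMetric_val_eq_pullbackBilin M a (Kerr.rPlus M a)
    have h1 : pullbackBilin (I := 𝓘(ℝ, E4)) (I' := 𝓘(ℝ, E4)) ι
        (Kerr.smoothMetric M a 0).toPseudoRiemannianMetric.val =
        pullbackBilin (I := 𝓘(ℝ, E4)) (I' := 𝓘(ℝ, E4)) Φ.symm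
          (Kerr.smoothMetric M a (Kerr.rPlus M a)).toPseudoRiemannianMetric.val := by
      rw [hval0, hvalP, ← pullbackBilin_comp hval_region hmdι, hvalι,
        pullbackBilin_comp hval_ext (Φ.symm.contMDiff.mdifferentiable (by simp))]
    have h2 : (Kerr.smoothMetric M a (Kerr.rPlus M a)).toPseudoRiemannianMetric.val =
        pullbackBilin (I := 𝓘(ℝ, E4)) (I' := 𝓘(ℝ, E4)) Φ (η₄).toPseudoRiemannianMetric.val := by
      funext y
      exact (hiso.2 y).symm
    have h3 : pullbackBilin (I := 𝓘(ℝ, E4)) (I' := 𝓘(ℝ, E4)) Φ.symm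
        (pullbackBilin (I := 𝓘(ℝ, E4)) (I' := 𝓘(ℝ, E4)) Φ (η₄).toPseudoRiemannianMetric.val) =
        (η₄).toPseudoRiemannianMetric.val := by
      rw [← pullbackBilin_comp (Φ.contMDiff.mdifferentiable (by simp))
        (Φ.symm.contMDiff.mdifferentiable (by simp))]
      have hid : ((Φ : Kerr.region a (Kerr.rPlus M a) → E4) ∘ Φ.symm) = id := funext fun z ↦ Φ.apply_symm_apply z
      rw [hid, pullbackBilin_id]
    change pullbackBilin (I := 𝓘(ℝ, E4)) (I' := 𝓘(ℝ, E4)) ι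
        (Kerr.smoothMetric M a 0).toPseudoRiemannianMetric.val x =
      (η₄).toPseudoRiemannianMetric.val x
    rw [h1, h2, h3]
  · -- proper
    obtain ⟨x₀, hx₀, hx₀'⟩ := exists_mem_region_not_mem_exterior hMa
    intro hr
    have hmem : (⟨x₀, hx₀⟩ : Kerr.region a 0) ∈ Set.range ι := hr ▸ mem_univ _
    obtain ⟨z, hz⟩ := hmem
    apply hx₀'
    have h1 : (ι z).1 = (Φ.symm z : Kerr.region a (Kerr.rPlus M a)).1 := congrFun hvalι z
    have h2 : (ι z).1 = x₀ := congrArg Subtype.val hz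
    rw [← h2, h1]
    exact (Φ.symm z).2

end NoKerrChart

/-! ## The crux without h2 is false -/

section WithoutH2

/-- `Kerr.Facts` holds (all three fields are theorems of the tree). [folklore] -/
theorem kerrFacts : Kerr.Facts :=
  ⟨Kerr.isConnected_region_holds, Kerr.contMDiff_bilin_holds, Kerr.contMDiff_timeVector_holds⟩

/-- h1 at the Minkowski presentation: `η` is Ricci-flat. [folklore] -/
theorem h1_minkowskiBH [minkowskiBH.metric.HasLeviCivita] :
    minkowskiBH.metric.toPseudoRiemannianMetric.IsRicciFlat := by
  haveI : Minkowski.smoothMetric.toPseudoRiemannianMetric.HasLeviCivita := ‹_›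
  exact Minkowski.isRicciFlat_holds

/-- h3 at the Minkowski presentation: with EMPTY horizon `IsNonDegenerateHorizon` holds
trivially (`K = ∂ₜ`, `κ = 1`) — the *Warning* of `Stationary.lean` made concrete. [folklore] -/
theorem h3_minkowskiBH [minkowskiBH.metric.HasLeviCivita] :
    minkowskiBH.toSpacetime.IsNonDegenerateHorizon minkowskiBH.Mext := by
  refine ⟨minkowskiBH.killing, minkowskiBH.isStationary.isKillingField, ?_, ?_, 1, one_ne_zero, ?_⟩
  · intro p hp
    exact absurd (horizon_minkowskiBH ▸ hp : p ∈ (∅ : Set E4)) (Set.notMem_empty p)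
  · intro γ _ h0
    exact absurd (horizon_minkowskiBH ▸ h0 : γ 0 ∈ (∅ : Set E4)) (Set.notMem_empty _)
  · intro p hp
    exact absurd (horizon_minkowskiBH ▸ hp : p ∈ (∅ : Set E4)) (Set.notMem_empty p)

/-- h4 at the Minkowski presentation: Minkowski spacetime is globally hyperbolic. [folklore] -/
theorem h4_minkowskiBH : minkowskiBH.metric.IsGloballyHyperbolic minkowskiBH.timeOrientation :=
  Minkowski.isGloballyHyperbolic

/-- h5 at the Minkowski presentation: `∂ₜ ≠ 0`. [folklore] -/
theorem h5_minkowskiBH : ∀ p ∈ minkowskiBH.doc, minkowskiBH.killing p ≠ 0 :=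
  fun _ _ ↦ basisVector_zero_ne_zero

/-- h6 at the Minkowski presentation holds VACUOUSLY: a null vector `v` with `η(∂ₜ, v) = 0` has
`v⁰ = 0`, hence `η(v, v) = ‖v̲‖² = 0` forces `v = 0`, which `IsNull` excludes. [folklore] -/
theorem h6_minkowskiBH [minkowskiBH.metric.HasLeviCivita] :
    ∀ γ : ℝ → minkowskiBH.carrier, IsGeodesicOn minkowskiBH.metric.leviCivita γ (Set.Ici 0) →
      (∀ s : ℝ, 0 ≤ s → minkowskiBH.metric.IsNull (velocity (𝓡 4) γ s) ∧
        minkowskiBH.metric.val (γ s) (minkowskiBH.killing (γ s)) (velocity (𝓡 4) γ s) = 0) →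
      ∀ K : Set minkowskiBH.carrier, IsCompact K → K ⊆ minkowskiBH.doc →
        ∃ s : ℝ, 0 ≤ s ∧ γ s ∉ K := by
  intro γ _ hγ K _ _
  exfalso
  obtain ⟨⟨hnull, hne⟩, horth⟩ := hγ 0 le_rfl
  set v : E4 := velocity (𝓡 4) γ 0 with hv
  change Minkowski.bilin v v = 0 at hnull
  change Minkowski.bilin (E4.basisVector 0) v = 0 at horth
  rw [Minkowski.bilin_basisVector_zero_left, neg_eq_zero] at horth
  apply hne
  change v = 0
  have hsum : ∑ i : Fin 3, v i.succ * v i.succ = 0 := by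
    rw [Minkowski.bilin_apply, horth] at hnull
    simpa using hnull
  have hsp : ∀ i : Fin 3, v i.succ = 0 := fun i ↦
    mul_self_eq_zero.1 <| (Finset.sum_eq_zero_iff_of_nonneg
      (fun j _ ↦ mul_self_nonneg (v (Fin.succ j)))).1 hsum i (Finset.mem_univ _)
  ext μ
  refine Fin.cases ?_ (fun i ↦ ?_) μ
  · simpa using horth
  · simpa using hsp i

/-- The conclusion of the crux FAILS at the Minkowski presentation: its d.o.c. `ℝ⁴` is not a
Kerr exterior. [folklore] -/
theorem not_kerrConclusion_minkowskiBH [Kerr.Facts] :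
    ¬ ∃ (M a : ℝ), Kerr.IsSubextremal M a ∧ ∃ Ψ : Kerr.exterior M a → minkowskiBH.carrier,
      Function.Injective Ψ ∧ Set.range Ψ = minkowskiBH.doc ∧
        PseudoRiemannianMetric.IsIsometricImmersion
          (Kerr.smoothMetric M a (Kerr.rPlus M a)).toPseudoRiemannianMetric
          minkowskiBH.metric.toPseudoRiemannianMetric Ψ := by
  rintro ⟨M, a, hMa, Ψ, hinj, hrange, hiso⟩
  rw [doc_minkowskiBH] at hrange
  exact false_of_kerrExterior_isometric_minkowski hMa Ψ hinj
    (Set.range_eq_univ.mp hrange) hiso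

/-- **Any proof of the crux must use h2** (`IsConnected 𝓑.horizon`, i.e. a NON-EMPTY future
event horizon): the crux `ZeroEnergyKerrOrBomb.ZeroEnergyRigidity`
(stmt-FinalStateConjecture-10690) with hypothesis h2 DELETED — all other hypotheses and the
conclusion verbatim — is FALSE.  Witness: Minkowski spacetime presented as a
`StationaryAFBlackHole` (`minkowskiBH`): vacuum, globally hyperbolic, `∂ₜ ≠ 0`, horizon
`∂I⁻(M_ext) ∩ I⁺(M_ext) = ∅` (so h3 and h6 hold vacuously while h2 fails), and its d.o.c. `ℝ⁴`
is `C⁰`-inextendible (Sbierski 2018), whereas every Kerr exterior extends into `{r > 0}`.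
[cite: SbierskiJDG2018, Thm. 1] -/
theorem zeroEnergyRigidity_false_without_H2 :
    ¬ ∀ (𝓑 : StationaryAFBlackHole.{0}) [𝓑.metric.HasLeviCivita] [Kerr.Facts],
      𝓑.metric.toPseudoRiemannianMetric.IsRicciFlat →
      𝓑.toSpacetime.IsNonDegenerateHorizon 𝓑.Mext →
      𝓑.metric.IsGloballyHyperbolic 𝓑.timeOrientation →
      (∀ p ∈ 𝓑.doc, 𝓑.killing p ≠ 0) →
      (∀ γ : ℝ → 𝓑.carrier, IsGeodesicOn 𝓑.metric.leviCivita γ (Set.Ici 0) →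
        (∀ s : ℝ, 0 ≤ s → 𝓑.metric.IsNull (velocity (𝓡 4) γ s) ∧
          𝓑.metric.val (γ s) (𝓑.killing (γ s)) (velocity (𝓡 4) γ s) = 0) →
        ∀ K : Set 𝓑.carrier, IsCompact K → K ⊆ 𝓑.doc → ∃ s : ℝ, 0 ≤ s ∧ γ s ∉ K) →
      ∃ (M a : ℝ), Kerr.IsSubextremal M a ∧ ∃ Ψ : Kerr.exterior M a → 𝓑.carrier,
        Function.Injective Ψ ∧ Set.range Ψ = 𝓑.doc ∧
          PseudoRiemannianMetric.IsIsometricImmersion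
            (Kerr.smoothMetric M a (Kerr.rPlus M a)).toPseudoRiemannianMetric
            𝓑.metric.toPseudoRiemannianMetric Ψ := by
  intro h
  haveI : Kerr.Facts := kerrFacts
  haveI : minkowskiBH.metric.HasLeviCivita :=
    minkowskiBH.metric.toPseudoRiemannianMetric.hasLeviCivita
  exact not_kerrConclusion_minkowskiBH
    (h minkowskiBH h1_minkowskiBH h3_minkowskiBH h4_minkowskiBH h5_minkowskiBH h6_minkowskiBH)

/-- The same witness refutes the weakening of h2 to `Nonempty`-free forms one might try at a
restate: the hypotheses h1, h3, h4, h5, h6 of the crux are JOINTLY SATISFIABLE by a presentation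
with EMPTY future event horizon whose conclusion fails. [folklore] -/
theorem exists_presentation_empty_horizon_not_kerr :
    ∃ (𝓑 : StationaryAFBlackHole.{0}) (_ : 𝓑.metric.HasLeviCivita) (_ : Kerr.Facts),
      𝓑.horizon = ∅ ∧ 𝓑.metric.toPseudoRiemannianMetric.IsRicciFlat ∧
      𝓑.toSpacetime.IsNonDegenerateHorizon 𝓑.Mext ∧
      𝓑.metric.IsGloballyHyperbolic 𝓑.timeOrientation ∧ (∀ p ∈ 𝓑.doc, 𝓑.killing p ≠ 0) ∧
      ¬ ∃ (M a : ℝ), Kerr.IsSubextremal M a ∧ ∃ Ψ : Kerr.exterior M a → 𝓑.carrier,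
        Function.Injective Ψ ∧ Set.range Ψ = 𝓑.doc ∧
          PseudoRiemannianMetric.IsIsometricImmersion
            (Kerr.smoothMetric M a (Kerr.rPlus M a)).toPseudoRiemannianMetric
            𝓑.metric.toPseudoRiemannianMetric Ψ := by
  haveI hK : Kerr.Facts := kerrFacts
  haveI hL : minkowskiBH.metric.HasLeviCivita :=
    minkowskiBH.metric.toPseudoRiemannianMetric.hasLeviCivita
  exact ⟨minkowskiBH, hL, hK, horizon_minkowskiBH, h1_minkowskiBH, h3_minkowskiBH,
    h4_minkowskiBH, h5_minkowskiBH, not_kerrConclusion_minkowskiBH⟩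

end WithoutH2

end Summit.FinalStateConjecture.FinalStateConjecture.Theorems.ZeroEnergyRigidity.Negative

end
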